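import Summits.ResolutionOfSingularities.ResolutionOfSingularities.Theorems.WeightedInvariantHypersurfaceLocalGameEFT4SDimOneGame
import Summits.ResolutionOfSingularities.ResolutionOfSingularities.Theorems.WeightedInvariantHypersurfaceLocalGameEFTCurveMoveChart
import HarnessLib

/-!
# The DIM-1 RUNG of the registered key H2a⁗-S `LocalWeightedDropEFT4S p` (door `HypersurfaceCentreConstruction`,
# stmt-ResolutionOfSingularities-19897), part 1b: the canonical game clause (c9′) in Krull dimension one, for every
# ISO-INVARIANT pair `(ι, J)` with `J = 𝔪ᵐ` on discrete valuation rings, and for the ADOPTED concrete pair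
# `(iotaOrd, (g, m) ↦ (√(g))ᵐ)`

Topic: `Summits/ResolutionOfSingularities/ResolutionOfSingularities/Theorems`. Helper for the door item
`HypersurfaceCentreConstruction` (stmt-ResolutionOfSingularities-19897, route `WeightedInvariant`), ORDER (o23) of the door
registrar res-L1-w43-plan-1 (2026-08-27T06:29:38Z): «BC5-type witness for H2a⁗-S itself, not only for EFT′ — for EACH of the
two position-dependent clauses of `LocalWeightedDropEFT4S p` prove its restriction to `ringKrullDim S = 1` for a CONCRETE pair
`(ι, J)`», as SHARPENED by RULINGS gen 8 #1 (ii) (06:53:45Z, adopting res-type-061's input): «ONE intrinsic pair for (a)+(b),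
`ι = iotaOrd` and `J := m ↦ ((Ideal.span {F}).radical)^m` (NOT `𝔪_Rᵐ`: fails (open″)'s presentation at the 2-dim points `𝔮 ⊋ 𝔪`
of models with non-maximal `𝔪`)». Part 1 (`…LocalGameEFT4SDimOneGame.lean`, p507502, filed before that ruling) proved the rung for
every `J` that is `𝔪ᵐ` on ALL local rings (concrete pair: powers of the Jacobson radical); the adopted `J = (√(F))ᵐ` is `𝔪ᵐ` only
at the non-zero non-units of DISCRETE VALUATION RINGS, so this file proves the rung under that weaker hypothesis plus
`JIsoInvariant J`, DERIVED from part 1 (no second copy of the successor-clause argument: part 1's tuple for the Jacobson-power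
`J₀` is re-labelled — at a DVR `S` and `0 ≠ f ∈ 𝔪²` both `J S f m` and `J₀ S f m` are `𝔪ᵐ`, and `J(S_𝔪)(f) = (J S f)·S_𝔪` by
transport along `S ≃ S_𝔪`). Part 2
(`…LocalGameEFT4SDimOne.lean`) does the ∀-model open presentation (open″). [OURS · L1 W4.3] Replaces the role of NO printed
item; NOT a statement of the manuscript [claim: Hironaka2017, status: under-review]. AI work, weaker than expert review.

## What is proved (def-free)

`(ι, J)` is ANY pair with `ι` and `J` invariant under ring isomorphisms (clauses (c6) `IotaIsoInvariant`, `JIsoInvariant`) and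
`J` equal to the powers of the maximal ideal at the non-zero non-units of discrete valuation rings
(`∀ R DVR, 0 ≠ g ∈ 𝔪_R → J R g m = 𝔪_R ^ m`); the CONCRETE pair is `(iotaOrd, fun R _ g m => ((Ideal.span {g}).radical) ^ m)`
(the tree's order function `…IotaOrder` p500698, and the powers of the RADICAL OF THE EQUATION IDEAL — res-L1-w43-plan-1
RULINGS gen 8 #1 (ii) 06:53:45Z adopting res-type-061: not `𝔪_Rᵐ`, which fails (open″)'s presentation at the 2-dimensional
points above a non-closed dim-1 position), for which the hypotheses are discharged (`iotaOrd_isoInvariant`; `jRad_isoInvariant`,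
`jRad_eq_pow_maximalIdeal`).

* `J_localization_maximalIdeal_eq_of_isoInvariant` — for an iso-invariant `J` on a local `S`: `J(S_𝔪)(f) m = (J S f m)·S_𝔪`
  (transport along `IsLocalization.atUnits`; `map_ringEquiv_eq_map_toRingHom`).
* `canonicalGameClause_dimOne_of_isoInvariant` — the body of (c9′) `CanonicalGameClause p ι J` at every regular local `S` of
  Krull dimension `1` and `0 ≠ f ∈ 𝔪²`, for every iso-invariant `ι`, every iso-invariant `J` with
  `∀ R DVR, 0 ≠ g ∈ 𝔪_R → J R g m = 𝔪_R ^ m` — from part 1's `canonicalGameClause_dimOne` for the Jacobson powers (same `ι`,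
  same centre, same move `u = (ϖ)`, `w = (1)`, same vacuous successor clause), re-labelling (pres) and re-proving (loc).
* `jRad_isoInvariant`, `jRad_eq_pow_maximalIdeal` — the adopted `J` qualifies; `canonicalGameClause_dimOne_iotaOrd_jRad` — the
  rung for the adopted concrete pair.

## References

* J. Włodarczyk, *Functorial resolution by torus actions*, arXiv:2203.03090, Def. 2.3.5 (full cobordant blow-up, vertex).
  [Wlodarczyk2022]
* H. Matsumura, *Commutative Ring Theory*, Thm. 11.2 (regular local of dimension one = DVR). [Matsumura1987]
-/

noncomputable section

open IsLocalRing Literature.AlgebraicGeometry.Resolution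
open Summit.ResolutionOfSingularities.ResolutionOfSingularities.Cruxes.HypersurfaceCentreConstruction.LocalEngine

set_option linter.dupNamespace false -- mandated namespace of this single-conjunct summit

namespace Summit.ResolutionOfSingularities.ResolutionOfSingularities.Theorems

namespace LocalGameEFT4SDimOneRad

variable {S : Type} [CommRing S]

/-- A ring isomorphism and its underlying ring homomorphism extend ideals identically. [folklore] -/
theorem map_ringEquiv_eq_map_toRingHom {R T : Type} [CommRing R] [CommRing T] (e : R ≃+* T) (I : Ideal R) :
    I.map e = I.map (e : R →+* T) := by
  rw [Ideal.map_comap_of_equiv, Ideal.comap_symm]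

/-- An iso-invariant `J` localises tautologically at the maximal ideal of a local ring: `J(S_𝔪)(f) m = (J S f m)·S_𝔪`
(transport along `S ≃ S_𝔪`). [folklore] -/
theorem J_localization_maximalIdeal_eq_of_isoInvariant [IsLocalRing S]
    (J : (R : Type) → [CommRing R] → R → ℕ → Ideal R) (hJiso : JIsoInvariant J) (f : S) (m : ℕ) :
    J (Localization.AtPrime (maximalIdeal S)) (algebraMap S (Localization.AtPrime (maximalIdeal S)) f) m =
      (J S f m).map (algebraMap S (Localization.AtPrime (maximalIdeal S))) := by
  have hunits : (maximalIdeal S).primeCompl ≤ IsUnit.submonoid S := by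
    intro x hx
    rw [IsUnit.mem_submonoid_iff]
    by_contra hnu
    exact hx ((IsLocalRing.mem_maximalIdeal x).mpr (mem_nonunits_iff.mpr hnu))
  let e : S ≃ₐ[S] Localization.AtPrime (maximalIdeal S) :=
    IsLocalization.atUnits S (maximalIdeal S).primeCompl hunits
  have he : ∀ x : S, e.toRingEquiv x = algebraMap S (Localization.AtPrime (maximalIdeal S)) x := fun x => by
    simpa using e.commutes x
  have hhom : (e.toRingEquiv : S →+* Localization.AtPrime (maximalIdeal S)) =
      algebraMap S (Localization.AtPrime (maximalIdeal S)) := RingHom.ext he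
  have h := hJiso S (Localization.AtPrime (maximalIdeal S)) e.toRingEquiv f m
  rw [he f, map_ringEquiv_eq_map_toRingHom, hhom] at h
  exact h

end LocalGameEFT4SDimOneRad

open LocalGameEFT4SDimOneRad

/-! ## (a′) The canonical game clause (c9′) in Krull dimension one, `J = 𝔪ᵐ` on discrete valuation rings only -/

/-- **(c9′) `CanonicalGameClause` in Krull dimension one — for every iso-invariant `ι`, every iso-invariant `J` that is `𝔪ᵐ` at
the non-zero non-units of discrete valuation rings.** Derived from part 1's `canonicalGameClause_dimOne` for the Jacobson-power
class function `J₀` (same `ι`): at the DVR `S`, `J S f m = 𝔪ᵐ = J₀ S f m`, so part 1's presentation re-labels; a prime containing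
`f ≠ 0` is `𝔪`, where `J(S_𝔪)(f) m = (J S f m)·S_𝔪` by iso-invariance (`J_localization_maximalIdeal_eq_of_isoInvariant`).
[OURS · L1 W4.3 · (o23)(a) dim-1 rung of H2a⁗-S] -/
theorem canonicalGameClause_dimOne_of_isoInvariant
    (ι : (R : Type) → [CommRing R] → R → Ordinal.{0}) (hι : IotaIsoInvariant ι)
    (J : (R : Type) → [CommRing R] → R → ℕ → Ideal R) (hJiso : JIsoInvariant J)
    (hJ : ∀ (R : Type) [CommRing R] [IsDomain R] [IsDiscreteValuationRing R] (g : R),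
      g ≠ 0 → g ∈ maximalIdeal R → ∀ m : ℕ, J R g m = (maximalIdeal R) ^ m)
    (S : Type) [CommRing S] [IsRegularLocalRing S] (hdim : ringKrullDim S = 1)
    (f : S) (hf0 : f ≠ 0) (hf2 : f ∈ (maximalIdeal S) ^ 2) :
    ∃ (P : Ideal S), P.IsPrime ∧ IsRegularLocalRing (S ⧸ P) ∧ f ∈ P ∧
      (∀ (𝔭 : Ideal S) [𝔭.IsPrime], f ∈ 𝔭 →
        (ι (Localization.AtPrime 𝔭) (algebraMap S (Localization.AtPrime 𝔭) f) = ι S f ↔ P ≤ 𝔭)) ∧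
      (∀ (𝔭 : Ideal S) [𝔭.IsPrime], f ∈ 𝔭 → P ≤ 𝔭 → ∀ m : ℕ,
        J (Localization.AtPrime 𝔭) (algebraMap S (Localization.AtPrime 𝔭) f) m =
          (J S f m).map (algebraMap S (Localization.AtPrime 𝔭))) ∧
      ∃ (n : ℕ) (u : Fin n → S) (w : Fin n → ℕ),
        Ideal.span (Set.range u) = maximalIdeal S ∧ (maximalIdeal S).spanFinrank = n ∧ (∃ i, 0 < w i) ∧
        Ideal.span {x | ∃ i, 0 < w i ∧ x = u i} = P ∧
        (∀ m : ℕ, weightedMonomialIdeal u w m = J S f m) ∧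
        (∀ (Q : Ideal S) [Q.IsPrime], P ≤ Q →
          algebraMap S (Localization.AtPrime Q) f ∈ (maximalIdeal (Localization.AtPrime Q)) ^ 2) ∧
        ∀ (𝔫 : Ideal (cobordantAlgebra' u w)) [𝔫.IsPrime],
          cobordantT' u w ∈ 𝔫 →
          P.map (algebraMap S (cobordantAlgebra' u w)) ≤ 𝔫 →
          ¬ (extReesAlgebra.vertexIdeal (weightedMonomialIdeal u w) ≤ 𝔫) →
          ∀ (a : ℕ) (g : cobordantAlgebra' u w),
            algebraMap S (cobordantAlgebra' u w) f = cobordantT' u w ^ a * g →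
            ¬ (cobordantT' u w ∣ g) →
            algebraMap (cobordantAlgebra' u w) (Localization.AtPrime 𝔫) g ∈
              (maximalIdeal (Localization.AtPrime 𝔫)) ^ 2 →
            ι (Localization.AtPrime 𝔫) (algebraMap (cobordantAlgebra' u w) (Localization.AtPrime 𝔫) g) < ι S f := by
  classical
  haveI := isDomain_of_isRegularLocalRing S
  haveI : IsDiscreteValuationRing S :=
    Literature.RingTheory.RegularLocalRing.isDiscreteValuationRing_of_ringKrullDim_eq_one hdim
  -- a prime containing `f ≠ 0` is the maximal ideal (dimension ≤ 1)
  have hprime : ∀ (𝔭 : Ideal S) [𝔭.IsPrime], f ∈ 𝔭 → 𝔭 = maximalIdeal S := by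
    intro 𝔭 _ hf𝔭
    have hne : 𝔭 ≠ ⊥ := by
      rintro rfl
      exact hf0 (Ideal.mem_bot.mp hf𝔭)
    exact IsLocalRing.eq_maximalIdeal (Ring.DimensionLEOne.maximalOfPrime hne inferInstance)
  -- at the DVR `S`: `J S f m = 𝔪ᵐ = J₀ S f m`
  have hJS : ∀ m : ℕ, J S f m = (Ideal.jacobson (⊥ : Ideal S)) ^ m := fun m => by
    rw [hJ S f hf0 (Ideal.pow_le_self two_ne_zero hf2) m, jacobson_bot_pow_eq S f m]
  -- part 1's tuple for `J₀ = (Jacobson radical)ᵐ`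
  obtain ⟨P, hP, hreg, hfP, hstrat, -, n, u, w, hspan, hrk, hpos, hctr, hpres, hadm, hsucc⟩ :=
    canonicalGameClause_dimOne ι hι (fun (R : Type) _ (_ : R) (m : ℕ) => (Ideal.jacobson (⊥ : Ideal R)) ^ m)
      jacobson_bot_pow_eq S hdim f hf0 hf2
  refine ⟨P, hP, hreg, hfP, hstrat, ?_, n, u, w, hspan, hrk, hpos, hctr, fun m => (hpres m).trans (hJS m).symm, hadm,
    hsucc⟩
  -- (loc) for `J`: the only prime is `𝔪`, transport along `S ≃ S_𝔪`
  intro 𝔭 _ hf𝔭 _ m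
  have h𝔭 := hprime 𝔭 hf𝔭
  subst h𝔭
  exact J_localization_maximalIdeal_eq_of_isoInvariant J hJiso f m

/-! ## (c′) The adopted concrete pair `(iotaOrd, powers of the radical of the equation ideal)` -/

/-- **`J_rad : (R, g, m) ↦ (√(g))ᵐ` is invariant under ring isomorphisms** (clause `JIsoInvariant`). [folklore] -/
theorem jRad_isoInvariant : JIsoInvariant (fun (R : Type) _ (g : R) (m : ℕ) => ((Ideal.span {g}).radical) ^ m) := by
  intro R T _ _ e g m
  simp only
  rw [map_ringEquiv_eq_map_toRingHom, Ideal.map_pow,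
    Ideal.map_radical_of_surjective (f := (e : R →+* T)) e.surjective (by
      intro x hx
      rw [RingHom.mem_ker] at hx
      have : x = 0 := e.injective (by simpa using hx)
      rw [this]; exact zero_mem _),
    Ideal.map_span, Set.image_singleton]
  rfl

/-- **At a non-zero non-unit of a discrete valuation ring, `(√(g))ᵐ = 𝔪ᵐ`** (`(g) = (ϖᵏ)`, `k ≥ 1`, `√(ϖᵏ) = (ϖ) = 𝔪`).
[folklore] -/
theorem jRad_eq_pow_maximalIdeal (R : Type) [CommRing R] [IsDomain R] [IsDiscreteValuationRing R] (g : R)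
    (hg0 : g ≠ 0) (hgm : g ∈ maximalIdeal R) (m : ℕ) :
    ((Ideal.span {g}).radical) ^ m = (maximalIdeal R) ^ m := by
  obtain ⟨ϖ, hirr⟩ := IsDiscreteValuationRing.exists_irreducible R
  have h𝔪 : maximalIdeal R = Ideal.span {ϖ} := (IsDiscreteValuationRing.irreducible_iff_uniformizer ϖ).mp hirr
  obtain ⟨k, u, hgu⟩ := IsDiscreteValuationRing.eq_unit_mul_pow_irreducible hg0 hirr
  have hk : k ≠ 0 := by
    rintro rfl
    rw [pow_zero, mul_one] at hgu
    exact (mem_nonunits_iff.mp ((IsLocalRing.mem_maximalIdeal g).mp hgm)) (hgu ▸ u.isUnit)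
  congr 1
  rw [hgu, Ideal.span_singleton_mul_left_unit u.isUnit, ← Ideal.span_singleton_pow, ← h𝔪, Ideal.radical_pow _ hk,
    Ideal.IsPrime.radical inferInstance]

/-- **(o23)(a) for the concrete pair** `(ι, J) = (iotaOrd, (g, m) ↦ (√(g))ᵐ)`: the (c9′) canonical game clause at every regular
local ring of Krull dimension `1`. [OURS · L1 W4.3 · (o23)(a)] -/
theorem canonicalGameClause_dimOne_iotaOrd_jRad
    (S : Type) [CommRing S] [IsRegularLocalRing S] (hdim : ringKrullDim S = 1)
    (f : S) (hf0 : f ≠ 0) (hf2 : f ∈ (maximalIdeal S) ^ 2) :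
    ∃ (P : Ideal S), P.IsPrime ∧ IsRegularLocalRing (S ⧸ P) ∧ f ∈ P ∧
      (∀ (𝔭 : Ideal S) [𝔭.IsPrime], f ∈ 𝔭 →
        (iotaOrd (Localization.AtPrime 𝔭) (algebraMap S (Localization.AtPrime 𝔭) f) = iotaOrd S f ↔ P ≤ 𝔭)) ∧
      (∀ (𝔭 : Ideal S) [𝔭.IsPrime], f ∈ 𝔭 → P ≤ 𝔭 → ∀ m : ℕ,
        ((Ideal.span {algebraMap S (Localization.AtPrime 𝔭) f}).radical) ^ m =
          (((Ideal.span {f}).radical) ^ m).map (algebraMap S (Localization.AtPrime 𝔭))) ∧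
      ∃ (n : ℕ) (u : Fin n → S) (w : Fin n → ℕ),
        Ideal.span (Set.range u) = maximalIdeal S ∧ (maximalIdeal S).spanFinrank = n ∧ (∃ i, 0 < w i) ∧
        Ideal.span {x | ∃ i, 0 < w i ∧ x = u i} = P ∧
        (∀ m : ℕ, weightedMonomialIdeal u w m = ((Ideal.span {f}).radical) ^ m) ∧
        (∀ (Q : Ideal S) [Q.IsPrime], P ≤ Q →
          algebraMap S (Localization.AtPrime Q) f ∈ (maximalIdeal (Localization.AtPrime Q)) ^ 2) ∧
        ∀ (𝔫 : Ideal (cobordantAlgebra' u w)) [𝔫.IsPrime],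
          cobordantT' u w ∈ 𝔫 →
          P.map (algebraMap S (cobordantAlgebra' u w)) ≤ 𝔫 →
          ¬ (extReesAlgebra.vertexIdeal (weightedMonomialIdeal u w) ≤ 𝔫) →
          ∀ (a : ℕ) (g : cobordantAlgebra' u w),
            algebraMap S (cobordantAlgebra' u w) f = cobordantT' u w ^ a * g →
            ¬ (cobordantT' u w ∣ g) →
            algebraMap (cobordantAlgebra' u w) (Localization.AtPrime 𝔫) g ∈
              (maximalIdeal (Localization.AtPrime 𝔫)) ^ 2 →
            iotaOrd (Localization.AtPrime 𝔫) (algebraMap (cobordantAlgebra' u w) (Localization.AtPrime 𝔫) g) <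
              iotaOrd S f :=
  canonicalGameClause_dimOne_of_isoInvariant iotaOrd iotaOrd_isoInvariant (fun (R : Type) _ (g : R) (m : ℕ) => ((Ideal.span {g}).radical) ^ m)
    jRad_isoInvariant jRad_eq_pow_maximalIdeal S hdim f hf0 hf2

end Summit.ResolutionOfSingularities.ResolutionOfSingularities.Theorems

end
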